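import Summits.QuantumFields.YangMills.Theorems.BalabanUVNodesN06Row17LocalCentreEveryCubeOfKIdx
import Literature.MathematicalPhysics.QuantumFieldTheory.Balaban1983to89.B13DirichletLocalRoadPadLettersExists

/-!
# BalabanUVNodes ∕ N06 ([B9], `Dag.B9_main`) — ROW 17's LOCAL CLAUSE ON PRINT's CLASS (3.35) «FOR Mα₀ SUFFICIENTLY SMALL»: `hloc(U)` at EVERY enlarged cube `□̃(c)` of
# EVERY member for EVERY `U ∈ Reg335 cthr α₀` with `α₀ ≤ α₁(x)` — the L5 letters `hA`, the fibre count `hfib`, the radii `hR′ hR′R hsmall` and the (3.35) comparison `hCr`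
# of `…LocalCentreEveryCubeOfKIdx.posDefTr_padDeltaALocY_of_L5_of_regYP335_of_KIdx` ALL DISCHARGED by the end-to-end local-cube road at `U₀ = 1`

Track A of `YM-PLAN.md` (cell `pub-ymgap`, HUMAN RULING D-0062), node **N06** = [Balaban1985BackgroundPropagators] Thms 3.1–3.15; seat `pub-ymgap-dag-n06-j`
(bundle F5, rows 15–17), g28.  A HELPER (count-neutral, `--supports` only).

THE PRINT.  [B9] p. 416 (proof of Thm 3.11): *«Let us consider G_□(U) and let us make a gauge transformation to the gauge in which U = e^{iηA}, A small … G_□(e^{iηA}) =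
G_□(1)(I − V(A)G_□(1))⁻¹. In [4] we have proved that the operator G_□(1) is positive … thus G_□(e^{iηA}) is positive also for A sufficiently small, i.e., for Mα₀
sufficiently small»*; (3.35) p. 396; Cor. 3.6 p. 408.

WHAT.  g27's `posDefTr_padDeltaALocY_of_L5_of_regYP335_of_KIdx` gave `PosDefTr 1 (padDeltaALocY x.toKIdx parSymY parBY (cubeDomY x c) (cutMulY χP) (cutMulY χ) U)` for
`U` in print's class from: L5's pencil LETTERS `hA` at `U₀ = 1` with free `(loc, R, ρ, B)`, a fibre count `hfib`, radii `0 < R′ ≤ R`, the smallness `2·(B·(m_F c₀(1,ρ)^ν))·R′ <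
m_□·R` and the (3.35) comparison `2L⁴·(M·α₀)·(L^{j(c)}η)⁻¹ ≤ R′`.  The N10 lane's local-cube road is now END-TO-END in the tree
(`B13DirichletLocalRoadPadLettersLocated`: L1 w3 → L2 w5 → L3 w6 → local part w4 → L4 w3, every numeral located; `B13DirichletLocalRoadPadLettersExists`: every
numeric window witnessed): at `U₀ = 1` the letters EXIST with a cut-independent radius `R > 0`, rate `ρ > 0` and constant `B ≥ 0` at the bond reading
`bondReadingY` (fibre `(d+1)·N²`, `B13BlockBondReadingNumerals.card_fibre_bondReadingY_matrixUnits`).  THIS FILE chooses `R′` and `α₁` and concludes: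
* ★★★ `posDefTr_padDeltaALocY_of_regYP335_small` — for EVERY member `x` (given `2 ≤ d+1`, `0 < b₀`, `G ≤ U(N)`, `cthr ≤ 10`): **`∃ α₁ > 0` such that for EVERY cover
  cube `c`, EVERY block set `Dblk` inside `□̃(c)` (block cut `χ_P = blkIndY _ Dblk`), EVERY 0∕1 bond cut `χ` issuing from `□̃(c)`, EVERY `0 ≤ α₀ ≤ α₁` and EVERY
  `U ∈ (bg9YP … G x).Reg335 cthr α₀`: `PosDefTr 1 (padDeltaALocY x.toKIdx (parSymY _) (parBY _) (cubeDomY x c) (cutMulY (blkIndY _ Dblk)) (cutMulY χ) U)`** —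
  row 17's `hloc(U)` on print's class with NO displayed letter, radius or comparison: print's «for Mα₀ sufficiently small» as an explicit (member-dependent) `α₁`.
HONEST FRAMING.  A composition over landed files (`R′ = m_□R∕(W + m_□ + 1)`, `α₁ = R′η∕(2L⁴M)`, `(Lʲη)⁻¹ ≤ η⁻¹`); `α₁` depends on the member's index numerals (`k, L, N, d,
c_f, b₀, b₁, η`) — the located road's radius is k-DEPENDENT (dag-n10-w3 g5's LOCATED (c)); print's class-uniform `α₁` = the (3.37)-scaled pencil (N10's W-stations),
NOT this file; the block cut is the indicator of a block set inside `□̃(c)` (the road's `hDD`), not an arbitrary 0∕1 block function; COUNT-NEUTRAL; N06 ∕ N10 NOT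
discharged; K1⁹ OPEN, no registered stub proved; nothing continuum ∕ OS ∕ mass gap ∕ Clay.  0 `def`, 0 `sorry`.
-/
noncomputable section

namespace Summit.QuantumFields.YangMills.BalabanUVNodes.N06Row17LocalClauseOnReg335Small

open Finset
open Literature.MathematicalPhysics.QuantumFieldTheory.Balaban1983to89
open Literature.MathematicalPhysics.QuantumFieldTheory.Balaban1983to89.Node00
open Literature.MathematicalPhysics.QuantumFieldTheory.Balaban1983to89.Node00.OpsYDeltaALocal (padDeltaALocY)
open Literature.MathematicalPhysics.QuantumFieldTheory.Balaban1983to89.B9Thm311ReadingCoords (PosDefTr)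
open Literature.MathematicalPhysics.QuantumFieldTheory.Balaban1983to89.B9Thm37CubeCoverCommutators (cutMulY)
open Literature.MathematicalPhysics.QuantumFieldTheory.Balaban1983to89.B9Thm39CubeOpsAtLettersY (blkIndY blkIndY_zero_one)
open Literature.MathematicalPhysics.QuantumFieldTheory.Balaban1983to89.B6KLevelCensusIndexV1 (KIdx kGeo)
open Literature.MathematicalPhysics.QuantumFieldTheory.Balaban1983to89.B6GlobalChartV1 (PV boxEquiv)
open Literature.MathematicalPhysics.QuantumFieldTheory.Balaban1983to89.B9BackgroundsKLevelV1 (CfgV1 eta_pos_L_one_le_M_pos)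
open Literature.MathematicalPhysics.QuantumFieldTheory.Balaban1983to89.B9BackgroundsKLevelV1P (bg9YP)
open Literature.MathematicalPhysics.QuantumFieldTheory.Balaban1983to89.B9PinMembersKLevelV1 (MemberY)
open Literature.MathematicalPhysics.QuantumFieldTheory.Balaban1983to89.B6Cover236MultiLevelBlocks (cubes)
open Literature.MathematicalPhysics.QuantumFieldTheory.Balaban1983to89.B9WalkLettersCoordsS (cubeDomY)
open Literature.MathematicalPhysics.QuantumFieldTheory.Balaban1983to89.B6Geom246MultiLevelBox (blkOf)
open Literature.MathematicalPhysics.QuantumFieldTheory.Balaban1983to89.LatticeNorms (scaleLen)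
open Literature.MathematicalPhysics.QuantumFieldTheory.Balaban1983to89.B6RandomWalk (c0_nonneg)
open Literature.MathematicalPhysics.QuantumFieldTheory.Balaban1983to89.B13BlockBondReadingNumerals (bondReadingY card_fibre_bondReadingY_matrixUnits)
open Literature.MathematicalPhysics.QuantumFieldTheory.Balaban1983to89.B13DirichletLocalRoadPadLettersExists
  (exists_rawEntryLetters_toMatrix_padDeltaALocY_parSymY_prodCfg_one)
open Summit.QuantumFields.YangMills.BalabanUVNodes.N06Row17LocalCentreEveryCubeOfKIdx (posDefTr_padDeltaALocY_of_L5_of_regYP335_of_KIdx)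
open scoped Matrix
open scoped Matrix.Norms.L2Operator

variable {N : ℕ} [NeZero N] {d ℓ : ℕ} {hd : 1 ≤ d + 1} {hL : Odd (ℓ + 1) ∧ 1 < ℓ + 1} {b₀ b₁ : ℝ} {Mstar : ℕ}

/-- a smaller radius inside the letters ball on which the perturbation is small: `R′ = m·R∕(W + m + 1)` has `0 < R′ ≤ R` and `W·R′ < m·R`. [folklore] -/
private theorem small_radius {m R W : ℝ} (hm : 0 < m) (hR : 0 < R) (hW : 0 ≤ W) :
    ∃ R' : ℝ, 0 < R' ∧ R' ≤ R ∧ W * R' < m * R := by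
  refine ⟨m * R / (W + m + 1), by positivity, ?_, ?_⟩
  · rw [div_le_iff₀ (by positivity)]
    nlinarith
  · rw [show W * (m * R / (W + m + 1)) = m * R * (W / (W + m + 1)) by ring]
    have h : W / (W + m + 1) < 1 := by rw [div_lt_one (by positivity)]; linarith
    nlinarith [mul_pos hm hR]

/-- ★★★ **ROW 17's LOCAL CLAUSE ON (3.35) FOR `Mα₀` SUFFICIENTLY SMALL — EVERY CUBE, EVERY MEMBER, NO DISPLAYED LETTER.**  For `G ≤ U(N)`, a member `x`, `2 ≤ d + 1`,
`0 < b₀` and a class parameter `cthr ≤ 10` there is **`α₁ > 0`** (depending on the member's index numerals only) such that for EVERY cover cube `c`, EVERY block set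
`Dblk` whose blocks lie inside `□̃(c) = cubeDomY x c`, EVERY 0∕1 bond cut `χ` issuing from `□̃(c)`, EVERY `0 ≤ α₀ ≤ α₁` and EVERY `U ∈ (bg9YP … G x).Reg335 cthr α₀`:
**`PosDefTr 1 (padDeltaALocY x.toKIdx (parSymY _) (parBY _) (cubeDomY x c) (cutMulY (blkIndY _ Dblk)) (cutMulY χ) U)`** — g27's
`posDefTr_padDeltaALocY_of_L5_of_regYP335_of_KIdx` with `hA` ∕ `hfib` INHABITED by `B13DirichletLocalRoadPadLettersExists` (the end-to-end local-cube road at `U₀ = 1`,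
bond reading, fibre `(d+1)N²`), `R′ = m_□R∕(W + m_□ + 1)` (`W = 2·(B·(m_F·c₀(1,ρ)^{d+1}))`, `m_□ = min 1 γ₂(k−1)`), `α₁ = R′η∕(2L⁴M)` (`(Lʲη)⁻¹ ≤ η⁻¹`).
[cite: Balaban1985BackgroundPropagators, Thm 3.11 proof p.416 («for Mα₀ sufficiently small»), Cor. 3.6 p.408, (3.35) p.396, Sect. C pp.408–410, Thm 3.4 p.400, Thm 3.10 (3.107)–(3.108) p.416;
Balaban1984PropagatorsII, p.238 (T_□), (2.89) p.239, Lemma 2.4 (2.128) p.245, Lemma 2.1 (2.61) p.234; Balaban1988RG2Cluster, (2.5)–(2.7) pp.12–13, p.15] -/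
theorem posDefTr_padDeltaALocY_of_regYP335_small {G : Subgroup (Matrix (Fin N) (Fin N) ℂ)ˣ}
    (hG : G ≤ B7Prop2Explicit.unitaryUnits (Matrix (Fin N) (Fin N) ℂ)) (x : MemberY d ℓ hd hL b₀ b₁ Mstar) (hd2 : 2 ≤ d + 1) (hb₀ : 0 < b₀)
    {cthr : ℝ} (hc : cthr ≤ 10) :
    ∃ α₁ : ℝ, 0 < α₁ ∧ ∀ (c : ↥(cubes x.toKIdx.D.toDomains)) (Dblk : Finset (BlkY x.toKIdx)),
      (∀ z : SiteY x.toKIdx, blkOf x.toKIdx.D.toDomains z ∈ Dblk → z ∈ cubeDomY x c) →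
      ∀ χ : FBondY x.toKIdx → ℝ, (∀ b, χ b = 0 ∨ χ b = 1) → (∀ b, χ b ≠ 0 → boxEquiv x.toKIdx.hN b.src ∈ cubeDomY x c) →
      ∀ α₀ : ℝ, 0 ≤ α₀ → α₀ ≤ α₁ → ∀ U : CfgV1 (PV d ℓ x.m x.K hd hL) (Matrix (Fin N) (Fin N) ℂ),
        (bg9YP (Matrix (Fin N) (Fin N) ℂ) G x).Reg335 cthr α₀ U →
        PosDefTr (fun _ => (1 : ℝ))
          (padDeltaALocY x.toKIdx (parSymY x.toKIdx) (parBY x.toKIdx) (cubeDomY x c) (cutMulY (blkIndY x.toKIdx Dblk)) (cutMulY χ) U) := by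
  -- the letters at `U₀ = 1`, cut-independent `(R, ρ, B)`
  obtain ⟨R, hR, ρ, hρ, B, hB0, hA⟩ := exists_rawEntryLetters_toMatrix_padDeltaALocY_parSymY_prodCfg_one x.toKIdx hG (kGeo x.toKIdx).eta
  -- the centre number `m_□ = min 1 γ₂(k−1)` (g27's, member-uniform; `γ₂ = (…)⁻¹`)
  obtain ⟨m, hm⟩ : ∃ m : ℝ, m =
      min 1 (2 / ((12 * (((d + 1 : ℕ) : ℝ)) ^ 2 * (1 + 12 * (((d + 1 : ℕ) : ℝ)) * ((((ℓ + 1 : ℕ) : ℝ)) ^ (x.toKIdx.k - 1)) ^ 2))⁻¹ *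
              (((((ℓ + 1 : ℕ) : ℝ)) ^ (x.toKIdx.k - 1 + 1)) ^ (d + 1 + 1))⁻¹ *
                min (x.toKIdx.cf ^ 2 / 2) (b₀ * x.toKIdx.cf ^ 2 / ((((ℓ + 1 : ℕ) : ℝ)) ^ (x.toKIdx.k - 1 + 1)) ^ (d + 1 - 2))) +
          4 / (8 * x.toKIdx.cf ^ 2 / ((((ℓ + 1 : ℕ) : ℝ)) ^ x.toKIdx.k) ^ 2) *
            (1 + 4 * ((d + 1 : ℕ) : ℝ) * x.toKIdx.cf ^ 2 /
              ((12 * (((d + 1 : ℕ) : ℝ)) ^ 2 * (1 + 12 * (((d + 1 : ℕ) : ℝ)) * ((((ℓ + 1 : ℕ) : ℝ)) ^ (x.toKIdx.k - 1)) ^ 2))⁻¹ *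
                (((((ℓ + 1 : ℕ) : ℝ)) ^ (x.toKIdx.k - 1 + 1)) ^ (d + 1 + 1))⁻¹ *
                  min (x.toKIdx.cf ^ 2 / 2) (b₀ * x.toKIdx.cf ^ 2 / ((((ℓ + 1 : ℕ) : ℝ)) ^ (x.toKIdx.k - 1 + 1)) ^ (d + 1 - 2)))))⁻¹ := ⟨_, rfl⟩
  have hcf : 0 < x.toKIdx.cf ^ 2 := by have := x.toKIdx.hcf; positivity
  have hm0 : 0 < m := by rw [hm]; positivity
  -- the perturbation numeral `W = 2·(B·(m_F·c₀(1,ρ)^{d+1}))`, `m_F = (d+1)·N²`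
  have hW : 0 ≤ 2 * (B * ((((d + 1) * (N * N) : ℕ) : ℝ) * B6.c0 1 ρ ^ (d + 1))) := by
    have := c0_nonneg (1 : ℝ) ρ
    positivity
  obtain ⟨R', hR', hR'R, hsmall⟩ := small_radius hm0 hR hW
  -- the geometry numerals `η > 0`, `L ≥ 1`, `M > 0`
  obtain ⟨hη, hL1, hM⟩ := eta_pos_L_one_le_M_pos x.toKIdx
  refine ⟨R' * (kGeo x.toKIdx).eta / (2 * (kGeo x.toKIdx).L ^ 4 * (kGeo x.toKIdx).M), by positivity, ?_⟩
  intro c Dblk hDD χ hχ hχD α₀ hα₀ hα₁ U hreg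
  -- the (3.35) comparison at the cube's level: `2L⁴·(M·α₀)·(Lʲη)⁻¹ ≤ 2L⁴·M·α₁·η⁻¹ = R′`
  have hsc : (kGeo x.toKIdx).eta ≤ scaleLen (kGeo x.toKIdx).L (kGeo x.toKIdx).eta c.1.1 :=
    le_mul_of_one_le_left hη.le (one_le_pow₀ hL1)
  have hCr : 2 * (kGeo x.toKIdx).L ^ 4 * ((kGeo x.toKIdx).M * α₀) * (scaleLen (kGeo x.toKIdx).L (kGeo x.toKIdx).eta c.1.1)⁻¹ ≤ R' := by
    have hL4 : 0 < 2 * (kGeo x.toKIdx).L ^ 4 * (kGeo x.toKIdx).M := by positivity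
    calc 2 * (kGeo x.toKIdx).L ^ 4 * ((kGeo x.toKIdx).M * α₀) * (scaleLen (kGeo x.toKIdx).L (kGeo x.toKIdx).eta c.1.1)⁻¹
        ≤ 2 * (kGeo x.toKIdx).L ^ 4 * ((kGeo x.toKIdx).M * α₀) * ((kGeo x.toKIdx).eta)⁻¹ := by
          refine mul_le_mul_of_nonneg_left ((inv_le_inv₀ (lt_of_lt_of_le hη hsc) hη).2 hsc) ?_
          positivity
      _ ≤ 2 * (kGeo x.toKIdx).L ^ 4 * ((kGeo x.toKIdx).M * (R' * (kGeo x.toKIdx).eta / (2 * (kGeo x.toKIdx).L ^ 4 * (kGeo x.toKIdx).M))) *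
            ((kGeo x.toKIdx).eta)⁻¹ := by
          refine mul_le_mul_of_nonneg_right (mul_le_mul_of_nonneg_left (mul_le_mul_of_nonneg_left hα₁ hM.le) (by positivity)) ?_
          positivity
      _ = R' * ((kGeo x.toKIdx).eta * ((kGeo x.toKIdx).eta)⁻¹) * ((2 * (kGeo x.toKIdx).L ^ 4 * (kGeo x.toKIdx).M) / (2 * (kGeo x.toKIdx).L ^ 4 * (kGeo x.toKIdx).M)) := by
          ring
      _ = R' := by rw [mul_inv_cancel₀ hη.ne', div_self hL4.ne', mul_one, mul_one]
  -- g27's face with the letters, the fibre count, the radii and the comparison supplied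
  have hface := posDefTr_padDeltaALocY_of_L5_of_regYP335_of_KIdx x c (blkIndY_zero_one x.toKIdx Dblk) hχ hχD hd2 hb₀ hc hα₀ hreg
    (hA (cubeDomY x c) Dblk hDD χ hχ) hρ (card_fibre_bondReadingY_matrixUnits x.toKIdx x.toKIdx.hN) hR' hR'R
  rw [← hm] at hface
  exact hface hsmall hCr

end Summit.QuantumFields.YangMills.BalabanUVNodes.N06Row17LocalClauseOnReg335Small

end
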